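import Mathlib.LinearAlgebra.Dimension.OrzechProperty
import Mathlib.RingTheory.LocalRing.MaximalIdeal.Square
import Mathlib.RingTheory.Regular.RegularSequence
import Mathlib.RingTheory.RegularLocalRing.Defs
import Mathlib.Algebra.Category.Grp.Zero
import Mathlib.Algebra.Category.ModuleCat.ProjectiveDimension
import Mathlib.LinearAlgebra.Dimension.Free
import Mathlib.RingTheory.LocalProperties.ProjectiveDimension
import Mathlib.RingTheory.LocalRing.Module
import Mathlib.RingTheory.Regular.Free
import Mathlib.RingTheory.Regular.ProjectiveDimension
import Mathlib.RingTheory.Ideal.Quotient.Noetherian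
import Mathlib.Algebra.Module.LocalizedModule.IsLocalization
import Mathlib.Algebra.Module.LocalizedModule.Submodule
import Mathlib.RingTheory.KrullDimension.Regular
import Mathlib.RingTheory.Regular.IsSMulRegular
import Mathlib.RingTheory.Ideal.AssociatedPrime.Finiteness
import Literature.AlgebraicGeometry.Resolution.RegularLocalRings
import HarnessLib

/-!
# Regular local rings: proofs of Matsumura Thm. 14.3 and Thm. 19.3 (Serre)

Topic: `Literature/AlgebraicGeometry/Resolution`. This file DISCHARGES two of the named facts of
`Literature.AlgebraicGeometry.Resolution.RegularLocalRings`: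

* `Matsumura1987_14_3_holds : Matsumura1987_14_3` — a regular local ring is an integral domain;
* `Matsumura1987_19_3_holds : Matsumura1987_19_3` — the localisation of a regular local ring at a
  prime ideal is a regular local ring (Serre),

following H. Matsumura, *Commutative Ring Theory* (CUP 1986/87, transl. M. Reid), §14 and §19, on
top of the pinned Mathlib's `IsRegularLocalRing`, `CategoryTheory.HasProjectiveDimensionLT`,
`RingTheory.Sequence.IsRegular` and `ModuleCat.localizedModule_hasProjectiveDimensionLE`.

## The printed argument (Matsumura, PDF pp. 122–123, 156, 170–173) and its formalisation

* **Thm. 14.2/14.3** (Part I): for `x ∈ 𝔪 ∖ 𝔪²`, `R/xR` is regular of dimension `dim R - 1`;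
  induction on `dim R` with prime avoidance and NAK gives that `R` is a domain
  (`isDomain_of_isRegularLocalRing`); consequently a regular system of parameters is an
  `R`-sequence (`isRegular_of_span_eq_maximalIdeal`, `exists_isRegular_ofList_eq_maximalIdeal`).
* **Thm. 19.2 (I)** (Part II): if `𝔪 = (x₁, …, x_d)` with `x₁, …, x_d` an `A`-sequence then every
  finite `A`-module has projective dimension `≤ d`
  (`hasProjectiveDimensionLE_of_maximalIdeal_eq_ofList`). The book uses the Koszul complex and
  §19 Lemma 1 (`proj dim M ≤ proj dim k`); we induct on `d` instead: a first syzygy `K` of `M` is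
  `x₁`-regular, and `proj dim_A K = proj dim_{A/x₁} K/x₁K` by **§18 Lemma 2**
  (`hasProjectiveDimensionLE_quotSMulTop_iff`).
* **Thm. 19.2 (II)** (Parts II–III): if `proj dim_A 𝔪 < ∞` then `A` is regular
  (`IsRegularLocalRing.of_maximalIdeal_hasProjectiveDimensionLE`): `𝔪 ∉ Ass(A)` by the
  minimal-resolution argument "`L_r ⊂ 𝔪L_{r-1}`, `aL_r = 0`"
  (`free_of_hasProjectiveDimensionLE_of_smul_eq_zero`, via minimal presentations
  `exists_free_surjective_ker_le_smul_top`); prime avoidance gives an `A`-regular `x ∈ 𝔪 ∖ 𝔪²`;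
  `𝔪/xA` is a direct summand of `𝔪/x𝔪`, so the maximal ideal of `B = A/xA` again has finite
  projective dimension; induction on `emb dim` produces an `A`-sequence generating `𝔪`
  (`generate_by_regular`), whence `emb dim A ≤ dim A`.
* **Thm. 19.3** (Part III): `proj dim_A P ≤ d` by (I); localising, the maximal ideal `P A_P` of
  `A_P` has projective dimension `≤ d` over `A_P`
  (`hasProjectiveDimensionLE_maximalIdeal_localization`); conclude by (II)
  (`isRegularLocalRing_localization_atPrime`).

Lean code of Part I, of `hasProjectiveDimensionLE_quotSMulTop_iff` and of `generate_by_regular`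
is adapted (ported to the pinned Mathlib, Auslander–Buchsbaum dependence removed) from the open
mathlib4 pull requests #28683 and #29802 by Nailin Guan (Apache-2.0 licence, same as Mathlib).

## Main results

* `isDomain_of_isRegularLocalRing`, `Matsumura1987_14_3_holds` — Thm. 14.3.
* `quotient_isRegularLocalRing_tfae`, `quotient_span_singleton` — Thm. 14.2.
* `hasProjectiveDimensionLE_quotSMulTop_iff` — §18 Lemma 2 (projective dimension modulo a regular
  element).
* `hasProjectiveDimensionLE_length_of_isWeaklyRegular` — Thm. 19.2 (I).
* `IsRegularLocalRing.of_maximalIdeal_hasProjectiveDimensionLE` — Thm. 19.2 (iii) ⇒ (i) (Serre).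
* `isRegularLocalRing_localization_atPrime`, `Matsumura1987_19_3_holds` — Thm. 19.3 (Serre).
-/

noncomputable section

/-! ## Part I. Regular local rings: Thm. 14.2 and Thm. 14.3 (domain), regular systems of
parameters are regular sequences

Lean proofs in this part are adapted from mathlib4 PRs #28683/#29802 (Nailin Guan, Apache-2.0),
ported to the pinned Mathlib. -/

namespace Literature.AlgebraicGeometry.Resolution

open IsLocalRing IsRegularLocalRing

universe u

variable (R : Type u) [CommRing R]

section cotangent

variable [IsLocalRing R]

variable {R} in
/-- For a surjective homomorphism `R → S` of Noetherian local rings with kernel `I`,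
`emb dim S + dim_k ((I ∩ 𝔪 + 𝔪²)/𝔪²) = emb dim R` (the cotangent space of `S` is the quotient
of that of `R` by the image of `I`). [folklore] -/
lemma spanFinrank_maximalIdeal_add_finrank_eq_of_surjective
    [IsNoetherianRing R] {S : Type*} [CommRing S] [IsLocalRing S] [Algebra R S]
    (surj : Function.Surjective (algebraMap R S)) [IsLocalHom (algebraMap R S)] :
    (maximalIdeal S).spanFinrank + Module.finrank (ResidueField R)
      (Submodule.span (ResidueField R) ((maximalIdeal R).toCotangent ''
        (Submodule.comap (maximalIdeal R).subtype (RingHom.ker (algebraMap R S)) :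
          Set (maximalIdeal R)))) = (maximalIdeal R).spanFinrank := by
  have : IsNoetherianRing S := isNoetherianRing_of_surjective R S (algebraMap R S) surj
  let f := (maximalIdeal R).mapCotangent (maximalIdeal S) (Algebra.ofId R S) (fun x hx ↦ by simpa)
  have eqsup : (maximalIdeal S).comap (algebraMap R S) =
    RingHom.ker (algebraMap R S) ⊔ (maximalIdeal R) := by
    simpa [maximalIdeal_comap] using le_maximalIdeal (RingHom.ker_ne_top _)
  set N := Submodule.comap (maximalIdeal R).subtype (RingHom.ker (algebraMap R S)) with hN
  let toCot := Submodule.span (ResidueField R)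
    ((maximalIdeal R).toCotangent '' (N : Set (maximalIdeal R)))
  let Q := (CotangentSpace R) ⧸ toCot
  have ker : (LinearMap.ker f : Set (maximalIdeal R).Cotangent) = toCot := by
    rw [Ideal.mapCotangent_ker_of_surjective surj eqsup]
    have h1 : Submodule.comap (maximalIdeal R).subtype
        (RingHom.ker (algebraMap R S) ⊓ maximalIdeal R) = N := by
      rw [Submodule.comap_inf, hN, Submodule.comap_subtype_self, inf_top_eq]
    rw [h1, show (toCot : Set (CotangentSpace R)) = (toCot.restrictScalars R : Set _) from rfl,
      Submodule.restrictScalars_span R (ResidueField R) Ideal.Quotient.mk_surjective,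
      ← Submodule.map_span, Submodule.span_eq]
  let f' : Q →+ CotangentSpace S :=
    QuotientAddGroup.lift _ f (fun x hx ↦ (Set.ext_iff.mp ker x).mpr hx)
  have bij : Function.Bijective f' := by
    constructor
    · rw [← AddMonoidHom.ker_eq_bot_iff, eq_bot_iff]
      intro x hx
      obtain ⟨x, rfl⟩ := QuotientAddGroup.mk_surjective x
      exact (QuotientAddGroup.eq_zero_iff _).mpr ((Set.ext_iff.mp ker x).mp hx)
    · apply QuotientAddGroup.lift_surjective_of_surjective
      exact Ideal.mapCotangent_surjective_of_comap_eq surj eqsup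
  let e : Q ≃+ CotangentSpace S := AddEquiv.ofBijective f' bij
  have (r : ResidueField R) (m : Q) : e (r • m) = (ResidueField.map (algebraMap R S)) r • e m := by
    obtain ⟨m, rfl⟩ := Submodule.Quotient.mk_surjective _ m
    obtain ⟨r, rfl⟩ := residue_surjective r
    exact (map_smul f r m).trans (algebraMap_smul S r _).symm
  have bij' : Function.Bijective (ResidueField.map (algebraMap R S)) :=
    ⟨RingHom.injective _, Ideal.Quotient.lift_surjective_of_surjective _ _
      (Ideal.Quotient.mk_surjective.comp surj)⟩
  have rk := lift_rank_eq_of_equiv_equiv (ResidueField.map (algebraMap R S)) e bij' this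
  have frk : Module.finrank (ResidueField R) Q =
    Module.finrank (ResidueField S) (CotangentSpace S) := by
    simpa [Module.finrank] using! congrArg Cardinal.toNat rk
  simp only [spanFinrank_maximalIdeal_eq_finrank_cotangentSpace]
  rw [← frk, Submodule.finrank_quotient_add_finrank]

end cotangent

variable {R} in
/-- If `S ⊆ 𝔪` is a finite set whose image in `𝔪/𝔪²` is linearly independent (part of a minimal
basis of `𝔪`), then `emb dim R/(S) + #S = emb dim R` (Matsumura §14, p. 121: "the smallest number of
elements needed to generate `𝔪` is `rank_k 𝔪/𝔪²`"). [folklore] -/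
lemma spanFinrank_maximalIdeal_quotient_add_card [IsLocalRing R] [IsNoetherianRing R]
    (S : Finset R) (sub : (S : Set R) ⊆ maximalIdeal R)
    (li : LinearIndependent (ResidueField R) ((maximalIdeal R).toCotangent ∘ (Set.inclusion sub))) :
    letI : Nontrivial (R ⧸ Ideal.span (S : Set R)) := Ideal.Quotient.nontrivial_iff.mpr
      (ne_top_of_le_ne_top Ideal.IsPrime.ne_top' (Ideal.span_le.mpr sub))
    letI : IsLocalRing (R ⧸ Ideal.span (S : Set R)) :=
      IsLocalRing.of_surjective' _ Ideal.Quotient.mk_surjective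
    (Submodule.spanFinrank (maximalIdeal (R ⧸ Ideal.span (S : Set R)))) + S.card =
      (maximalIdeal R).spanFinrank := by
  have : Nontrivial (R ⧸ Ideal.span (S : Set R)) := Ideal.Quotient.nontrivial_iff.mpr
    (ne_top_of_le_ne_top Ideal.IsPrime.ne_top' (Ideal.span_le.mpr sub))
  have lochom : IsLocalHom (Ideal.Quotient.mk (Ideal.span (S : Set R))) :=
    IsLocalHom.of_surjective _ (Ideal.Quotient.mk_surjective)
  have : IsLocalRing (R ⧸ Ideal.span (S : Set R)) :=
    IsLocalRing.of_surjective _ Ideal.Quotient.mk_surjective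
  have : _ + Module.finrank (ResidueField R) (Submodule.span (ResidueField R)
    ((maximalIdeal R).toCotangent '' (Submodule.comap (maximalIdeal R).subtype
      (RingHom.ker (Ideal.Quotient.mk (Ideal.span (S : Set R)))) : Set (maximalIdeal R)))) = _ :=
    spanFinrank_maximalIdeal_add_finrank_eq_of_surjective
    (Ideal.Quotient.mk_surjective (I := Ideal.span (S : Set R)))
  convert this
  have : S = Set.range (Subtype.val ∘ Set.inclusion sub) := by
    rw [Set.val_comp_inclusion, Subtype.range_val]
  have eqmap : Ideal.span S =
    (Submodule.span R (Set.range (Set.inclusion sub))).map (maximalIdeal R).subtype := by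
    rw [Submodule.map_span, Ideal.submodule_span_eq, ← Set.range_comp]
    congr
  have : Submodule.comap (maximalIdeal R).subtype (Ideal.span S) =
    Submodule.span R (Set.range (Set.inclusion sub)) := by
    rw [eqmap, Submodule.comap_map_eq_of_injective (maximalIdeal R).subtype_injective]
  rw [Ideal.mk_ker, this, ← Submodule.map_coe, Submodule.map_span, Submodule.span_span_of_tower R,
    ← Set.range_comp]
  exact (Fintype.card_coe S).symm.trans (finrank_span_eq_card li).symm

/-- **Matsumura Thm. 14.2.** For an `n`-dimensional regular local ring `(R, 𝔪)` and a finite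
`S ⊆ 𝔪`, TFAE: (1) `S` is a subset of a regular system of parameters (a generating set of `𝔪` with
`dim R` elements); (2) the images of the elements of `S` in `𝔪/𝔪²` are linearly independent over
`R/𝔪`; (3) `R/(S)` is an `(n - #S)`-dimensional regular local ring.
[cite: Matsumura1987, Thm. 14.2] -/
lemma quotient_isRegularLocalRing_tfae [IsRegularLocalRing R] (S : Finset R)
    (sub : (S : Set R) ⊆ maximalIdeal R) :
    [∃ (T : Finset R), S ⊆ T ∧ T.card = ringKrullDim R ∧ Ideal.span T = maximalIdeal R,
     LinearIndependent (ResidueField R) ((⇑(maximalIdeal R).toCotangent).comp (Set.inclusion sub)),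
     IsRegularLocalRing (R ⧸ Ideal.span (S : Set R)) ∧
     (ringKrullDim (R ⧸ Ideal.span (S : Set R)) + S.card = ringKrullDim R)].TFAE := by
  have : Nontrivial (R ⧸ Ideal.span (S : Set R)) := Ideal.Quotient.nontrivial_iff.mpr
    (ne_top_of_le_ne_top Ideal.IsPrime.ne_top' (Ideal.span_le.mpr sub))
  have lochom : IsLocalHom (Ideal.Quotient.mk (Ideal.span (S : Set R))) :=
    IsLocalHom.of_surjective _ (Ideal.Quotient.mk_surjective)
  tfae_have 1 → 2 := by
    rintro ⟨T, h, card, span⟩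
    have Tsub : (T : Set R) ⊆ maximalIdeal R := by simp [← span]
    have : LinearIndependent (ResidueField R)
      ((⇑(maximalIdeal R).toCotangent).comp (Set.inclusion Tsub)) := by
      apply linearIndependent_of_top_le_span_of_card_eq_finrank
      · suffices Submodule.span R (((↑) : maximalIdeal R → R) ⁻¹' T) = ⊤ by
          simpa [Set.range_comp, CotangentSpace.span_image_eq_top_iff, Set.range_inclusion Tsub]
        apply Submodule.map_injective_of_injective (maximalIdeal R).injective_subtype
        simp [Submodule.map_span, Set.image_preimage_eq_inter_range, -mem_maximalIdeal,
          Set.inter_eq_left.mpr Tsub, span]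
      · rw [← Nat.cast_inj (R := WithBot ℕ∞), (iff_finrank_cotangentSpace R).mp ‹_›, ← card]
        simp
    simpa [← Function.comp_assoc, ← Set.inclusion_comp_inclusion h Tsub] using
      this.comp _ (Set.inclusion_injective h)
  tfae_have 2 → 3 := by
    intro li
    let _ : IsLocalRing (R ⧸ Ideal.span (S : Set R)) :=
      IsLocalRing.of_surjective _ Ideal.Quotient.mk_surjective
    rw [isRegularLocalRing_iff]
    have le := ringKrullDim_le_ringKrullDim_quotient_add_card S
      (by simpa [IsLocalRing.ringJacobson_eq_maximalIdeal] using sub)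
    have ge : (Submodule.spanFinrank (maximalIdeal (R ⧸ Ideal.span (S : Set R)))) + S.card ≤
      ringKrullDim R := by
      simp [← Nat.cast_add, ← (isRegularLocalRing_iff R).mp ‹_›,
        spanFinrank_maximalIdeal_quotient_add_card S sub li]
    have : ringKrullDim (R ⧸ Ideal.span (S : Set R)) + S.card ≤
      (Submodule.spanFinrank (maximalIdeal (R ⧸ Ideal.span (S : Set R)))) + S.card :=
      add_le_add_left (ringKrullDim_le_spanFinrank_maximalIdeal _) _
    exact ⟨ENat.WithBot.add_natCast_cancel.mp (le_antisymm (ge.trans le) this),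
      le_antisymm (this.trans ge) le⟩
  tfae_have 3 → 1 := by
    classical
    rintro ⟨reg, dim⟩
    simp only [← (isRegularLocalRing_iff _).mp reg, ← Nat.cast_add, ←
      (isRegularLocalRing_iff R).mp ‹_›, Nat.cast_inj] at dim
    have fin : (maximalIdeal (R ⧸ Ideal.span (S : Set R))).generators.Finite :=
      (IsNoetherian.noetherian _).finite_generators
    let U := Quotient.out '' (maximalIdeal (R ⧸ Ideal.span (S : Set R))).generators
    let : Fintype U := (Set.Finite.image _ fin).fintype
    use S ∪ U.toFinset
    have span : Ideal.span (S ∪ U) = maximalIdeal R := by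
      rw [Ideal.span_union, ← Ideal.mk_ker (I := Ideal.span (S : Set R)), sup_comm,
        ← Ideal.comap_map_of_surjective' _ Ideal.Quotient.mk_surjective, Ideal.map_span]
      have : Ideal.span (⇑(Ideal.Quotient.mk (Ideal.span ↑S)) '' U) =
        Submodule.span _ (maximalIdeal (R ⧸ Ideal.span (S : Set R))).generators := by
        simp [U, ← Set.image_comp]
      rw [this, Submodule.span_generators, IsLocalRing.maximalIdeal_comap]
    simp only [Finset.subset_union_left, true_and, ← (isRegularLocalRing_iff R).mp ‹_›,
      Finset.coe_union, Set.coe_toFinset]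
    refine ⟨le_antisymm ?_ ?_, span⟩
    · apply Nat.cast_le.mpr (le_trans (Finset.card_union_le _ _) _)
      simp only [Set.toFinset_card, ← dim, add_comm, add_le_add_iff_left,
        Fintype.card_eq_nat_card, Nat.card_coe_set_eq]
      exact (Set.ncard_image_le fin).trans (le_of_eq (IsNoetherian.noetherian _).generators_ncard)
    · simp only [← span, ← Set.ncard_coe_finset, Finset.coe_union, Set.coe_toFinset, Nat.cast_le]
      exact Submodule.spanFinrank_span_le_ncard_of_finite (Set.toFinite (S ∪ U))
  tfae_finish

/-- **Matsumura Thm. 14.2**, case of one element: if `x ∈ 𝔪 ∖ 𝔪²` in a regular local ring `R`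
then `R/xR` is a regular local ring and `dim R/xR + 1 = dim R`. [cite: Matsumura1987, Thm. 14.2] -/
lemma quotient_span_singleton [IsRegularLocalRing R] {x : R} (mem : x ∈ maximalIdeal R)
    (nmem : x ∉ (maximalIdeal R) ^ 2) : IsRegularLocalRing (R ⧸ Ideal.span {x}) ∧
    (ringKrullDim (R ⧸ Ideal.span {x}) + 1 = ringKrullDim R) := by
  rw [← Nat.cast_one, ← Finset.card_singleton x, ← Finset.coe_singleton x]
  apply ((quotient_isRegularLocalRing_tfae R {x} (by simpa)).out 1 2).mp
  simpa [← LinearMap.mem_ker, Ideal.mem_toCotangent_ker] using nmem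

/-- A ring of finite Krull dimension (e.g. a Noetherian local ring) has dimension a natural
number. [folklore] -/
lemma ringKrullDim_eq_nat [FiniteRingKrullDim R] :
    ∃ n : ℕ, ringKrullDim R = n := by
  obtain ⟨m, hm⟩ := WithBot.ne_bot_iff_exists.mp (ringKrullDim_ne_bot (R := R))
  obtain ⟨n, hn⟩ := ENat.ne_top_iff_exists.mp
    (WithBot.coe_inj.not.mp (ne_of_eq_of_ne hm ringKrullDim_ne_top))
  exact ⟨n, ((WithBot.coe_inj.mpr hn).trans hm).symm⟩

variable {R} in
/-- If a prime `𝔭` is contained in `xR` with `x ∉ 𝔭` then `𝔭 = x𝔭` (the step "`y = xa`, `x ∉ 𝔭`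
gives `a ∈ 𝔭`" in the proof of Matsumura Thm. 14.3). [cite: Matsumura1987, Thm. 14.3 (proof)] -/
theorem span_singleton_mul_eq_self_of_isPrime {p : Ideal R} [p.IsPrime]
    (x : R) (hx : x ∉ p) (hp : p ≤ Ideal.span {x}) : Ideal.span {x} * p = p := by
  refine Ideal.mul_le_left.antisymm ?_
  intro y hyp
  obtain ⟨y, rfl⟩ := Ideal.mem_span_singleton.mp (hp hyp)
  exact Ideal.mul_mem_mul (Ideal.mem_span_singleton_self _)
    ((Ideal.IsPrime.mul_mem_left_iff hx).mp hyp)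

open Pointwise in
/-- **Matsumura Thm. 14.3**: "A regular local ring is an integral domain." Proof as printed:
induction on `dim R`; choose `x ∈ 𝔪` outside `𝔪²` and the minimal primes (prime avoidance), so
`R/xR` is regular of dimension `dim R - 1` (Thm. 14.2), hence a domain; a minimal prime `𝔭 ⊆ xR`
satisfies `𝔭 = x𝔭`, so `𝔭 = 0` by NAK. [cite: Matsumura1987, Thm. 14.3] -/
theorem isDomain_of_isRegularLocalRing [IsRegularLocalRing R] : IsDomain R := by
  obtain ⟨n, hn⟩ := ringKrullDim_eq_nat R
  induction n generalizing R with
  | zero =>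
    suffices IsField R from this.isDomain
    simpa [← (isRegularLocalRing_iff R).mp ‹_›, Submodule.spanFinrank_eq_zero_iff_eq_bot,
      IsNoetherian.noetherian, ← isField_iff_maximalIdeal_eq] using hn
  | succ n ih =>
    obtain ⟨x, xmem, xnmem⟩ :
        ∃ x ∈ maximalIdeal R, x ∉ ⋃ I ∈ (insert ((maximalIdeal R) ^ 2) (minimalPrimes R)), I := by
      by_contra! h
      have : ringKrullDim R ≠ 0 := hn.trans_ne (Nat.cast_inj.not.mpr (Nat.zero_ne_add_one n).symm)
      have lt := (maximalIdeal_sq_lt_maximalIdeal R).mpr (mt ringKrullDim_eq_zero_of_isField this)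
      have fin := (minimalPrimes.finite_of_isNoetherianRing R).insert ((maximalIdeal R) ^ 2)
      absurd (Ideal.subset_iUnion_iff_mem_of_isMaximal_of_finite fin _ _
        (fun I hI ne _ ↦ (Set.mem_of_mem_insert_of_ne hI ne).1.1) lt.ne_top lt.ne_top).mp h
      simp only [Set.mem_insert_iff, lt.ne.symm, ← Ideal.height_eq_zero_iff, false_or]
      rwa [← WithBot.coe_inj, maximalIdeal_height_eq_ringKrullDim]
    replace xnmem : x ∉ maximalIdeal R ^ 2 ∧ ∀ p ∈ minimalPrimes R, x ∉ p := by simpa using xnmem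
    obtain ⟨reg, dim⟩ := quotient_span_singleton R xmem xnmem.1
    simp only [hn, Nat.cast_add, Nat.cast_one] at dim
    have ih' := ih (R ⧸ Ideal.span {x}) (ENat.WithBot.add_one_cancel.mp dim)
    have : (Ideal.span {x}).IsPrime := (Ideal.Quotient.isDomain_iff_prime _).mp ih'
    obtain ⟨p, min, hp⟩ := Ideal.exists_minimalPrimes_le (bot_le (a := Ideal.span {x}))
    suffices p = ⊥ from @IsDomain.of_bot_isPrime R _ (this ▸ min.1.1)
    exact Submodule.eq_bot_of_eq_ideal_smul_of_le_jacobson_annihilator (IsNoetherian.noetherian _)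
      (@span_singleton_mul_eq_self_of_isPrime _ _ _ min.1.1 _ (xnmem.2 _ min) hp).symm
      (((Ideal.span_singleton_le_iff_mem _).mpr xmem).trans (maximalIdeal_le_jacobson _))

open RingTheory.Sequence in
/-- In a regular local ring, a list of `dim R` generators of the maximal ideal (a regular system of
parameters) is an `R`-regular sequence: each `R/(x₁, …, xᵢ)` is regular (Thm. 14.2) hence a domain
(Thm. 14.3), and `xᵢ₊₁` is nonzero in it. This is the fact "a regular system of parameters is an
`A`-sequence" used in the proof of Thm. 19.2 (I). [cite: Matsumura1987, Thms. 14.2, 14.3] -/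
theorem isRegular_of_span_eq_maximalIdeal [IsRegularLocalRing R] (rs : List R)
    (span : Ideal.ofList rs = maximalIdeal R) (len : rs.length = ringKrullDim R) :
    IsRegular R rs := by
  refine ⟨⟨fun i hi ↦ ?_⟩, by simpa [span] using Ideal.IsPrime.ne_top'.symm⟩
  rw [smul_eq_mul, Ideal.mul_top]
  classical
  have mem : (rs.toFinset : Set R) ⊆ maximalIdeal R := by simp [← span, Ideal.ofList]
  have sub : (List.take i rs).toFinset ⊆ rs.toFinset :=
    fun x ↦ by simpa using fun a ↦ List.mem_of_mem_take a
  have card : rs.toFinset.card = ringKrullDim R := by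
    apply le_antisymm (le_of_le_of_eq (Nat.cast_le.mpr rs.toFinset_card_le) len)
    simp only [← (isRegularLocalRing_iff R).mp ‹_›, Nat.cast_le, ← span, Ideal.ofList,
      ← List.coe_toFinset rs, ← Set.ncard_coe_finset rs.toFinset]
    exact (Submodule.spanFinrank_span_le_ncard_of_finite rs.toFinset.finite_toSet)
  have : IsDomain (R ⧸ Ideal.ofList (List.take i rs)) := by
    refine @isDomain_of_isRegularLocalRing _ _ ?_
    rw [Ideal.ofList, ← (List.take i rs).coe_toFinset]
    refine And.left (((quotient_isRegularLocalRing_tfae R (List.take i rs).toFinset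
      ((Finset.coe_subset.mpr sub).trans mem)).out 0 2).mp ?_)
    use rs.toFinset
    simpa [sub, card] using span
  have : (Ideal.Quotient.mk (Ideal.ofList (List.take i rs))) rs[i] ≠ 0 := by
    simp only [ne_eq, Ideal.Quotient.eq_zero_iff_mem]
    by_contra mem
    simp only [← (isRegularLocalRing_iff R).mp ‹_›, Nat.cast_inj] at len
    let rs' := (List.take i rs) ++ (List.drop (i + 1) rs)
    have span' : Ideal.ofList rs' = maximalIdeal R := by
      simp only [← span, rs']
      apply le_antisymm
      · apply Ideal.span_mono (fun x ↦ ?_)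
        simpa [or_imp] using ⟨fun a ↦ List.mem_of_mem_take a, fun a ↦ List.mem_of_mem_drop a⟩
      · apply Ideal.span_le.mpr
        intro x hx
        have : rs = List.take i rs ++ (rs[i] :: List.drop (i + 1) rs) := by
          rw [List.cons_getElem_drop_succ, List.take_append_drop]
        rw [Set.mem_setOf_eq, this, List.mem_append, List.mem_cons] at hx
        simp only [Ideal.ofList_append, SetLike.mem_coe]
        rcases hx with l|eq|r
        · exact Ideal.mem_sup_left (Ideal.subset_span (show x ∈ {r | r ∈ _} from l))
        · exact Ideal.mem_sup_left (eq ▸ mem)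
        · exact Ideal.mem_sup_right (Ideal.subset_span (show x ∈ {r | r ∈ _} from r))
    have : Submodule.spanFinrank (Ideal.ofList rs') ≤ rs'.length := by
      apply (Submodule.spanFinrank_span_le_ncard_of_finite rs'.finite_toSet).trans
      apply le_of_eq_of_le _ (List.toFinset_card_le rs')
      simp [← (Set.ncard_coe_finset rs'.toFinset)]
    simp only [span', ← len, List.length_append, List.length_take, List.length_drop, rs'] at this
    omega
  exact (IsRegular.of_ne_zero this).isSMulRegular

/-- A regular local ring admits an `R`-regular sequence of length `dim R` generating its maximal
ideal (any regular system of parameters). [cite: Matsumura1987, Thms. 14.2, 14.3] -/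
theorem exists_isRegular_ofList_eq_maximalIdeal [IsRegularLocalRing R] :
    ∃ rs : List R, RingTheory.Sequence.IsRegular R rs ∧ Ideal.ofList rs = maximalIdeal R ∧
      (rs.length : WithBot ℕ∞) = ringKrullDim R := by
  classical
  obtain ⟨s, hscard, hsspan⟩ := Submodule.FG.exists_span_finset_card_eq_spanFinrank
    (IsNoetherian.noetherian (maximalIdeal R))
  refine ⟨s.toList, ?_, ?_, ?_⟩
  · refine isRegular_of_span_eq_maximalIdeal R s.toList ?_ ?_
    · simpa [Ideal.ofList] using hsspan
    · rw [Finset.length_toList, hscard]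
      exact (isRegularLocalRing_iff R).mp ‹_›
  · simpa [Ideal.ofList] using hsspan
  · rw [Finset.length_toList, hscard]
    exact (isRegularLocalRing_iff R).mp ‹_›

end Literature.AlgebraicGeometry.Resolution

/-! ### Minimal generators containing a given `x ∈ 𝔪 ∖ 𝔪²`; the maximal ideal of a quotient

(Restored 2026-08-14: both lemmas were accepted with this file (p6121) and are used by
`RegularLocalRingsQuotient`, `SmoothImpliesRegular` and `SmoothUniformizationProofs`; a later
whole-file resubmission dropped them.) -/

namespace Literature.AlgebraicGeometry.Resolution

open IsLocalRing Module

universe u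

/-- **Matsumura, Thm. 2.3 / proof of 14.2**: in a Noetherian local ring, an element
`x ∈ 𝔪 ∖ 𝔪²` is part of a minimal system of generators of `𝔪`: there is a finite `s ⊆ R` with
`#s + 1 ≤ emb dim R` and `𝔪 = (x, s)`. [cite: Matsumura1987, Thm. 2.3] -/
theorem exists_span_insert_eq_maximalIdeal {R : Type u} [CommRing R] [IsLocalRing R]
    [IsNoetherianRing R] {x : R} (hx : x ∈ maximalIdeal R) (hx2 : x ∉ (maximalIdeal R) ^ 2) :
    ∃ s : Set R, s.Finite ∧ s.ncard + 1 ≤ (maximalIdeal R).spanFinrank ∧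
      Ideal.span (insert x s) = maximalIdeal R := by
  classical
  set m := maximalIdeal R with hm
  let v : CotangentSpace R := m.toCotangent ⟨x, hx⟩
  have hv : v ≠ 0 := fun h => hx2 ((m.toCotangent_eq_zero ⟨x, hx⟩).mp h)
  have hli : LinearIndepOn (ResidueField R) id ({v} : Set (CotangentSpace R)) :=
    LinearIndepOn.singleton hv
  set T : Set (CotangentSpace R) := hli.extend (Set.subset_univ _) with hT
  let b : Basis T (ResidueField R) (CotangentSpace R) := Basis.extend hli
  have hvT : v ∈ T := hli.subset_extend _ (Set.mem_singleton v)
  have hTfin : T.Finite := Set.finite_coe_iff.mp (Module.Finite.finite_basis b)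
  have hcard : T.ncard = m.spanFinrank := by
    rw [spanFinrank_maximalIdeal_eq_finrank_cotangentSpace, Module.finrank_eq_nat_card_basis b,
      Nat.card_coe_set_eq]
  have hspanT : Submodule.span (ResidueField R) T = ⊤ := by
    rw [← b.span_eq, Basis.range_extend]
  -- a section of `𝔪 → 𝔪/𝔪²`
  let σ : CotangentSpace R → m := Function.surjInv m.toCotangent_surjective
  have hσ : ∀ w, m.toCotangent (σ w) = w := Function.surjInv_eq m.toCotangent_surjective
  let S : Set m := insert ⟨x, hx⟩ (σ '' (T \ {v}))
  have hS : m.toCotangent '' S = T := by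
    simp only [S, Set.image_insert_eq, Set.image_image, hσ, Set.image_id']
    exact Set.insert_sdiff_singleton.trans (Set.insert_eq_of_mem hvT)
  have hspanS : Submodule.span R S = ⊤ := by
    rw [← CotangentSpace.span_image_eq_top_iff, hS, hspanT]
  refine ⟨(fun w : m => (w : R)) '' (σ '' (T \ {v})), (hTfin.sdiff.image _).image _, ?_, ?_⟩
  · have h1 : ((fun w : m => (w : R)) '' (σ '' (T \ {v}))).ncard ≤ (T \ {v}).ncard :=
      (Set.ncard_image_le (hTfin.sdiff.image _)).trans (Set.ncard_image_le hTfin.sdiff)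
    have h2 : (T \ {v}).ncard + 1 = T.ncard := Set.ncard_sdiff_singleton_add_one hvT hTfin
    omega
  · have : (insert x ((fun w : m => (w : R)) '' (σ '' (T \ {v})))) = m.subtype '' S := by
      simp only [S, Set.image_insert_eq, Submodule.coe_subtype]
    rw [this, Ideal.span, Submodule.span_image, hspanS, Submodule.map_top, Submodule.range_subtype]

/-- The maximal ideal of a quotient of a local ring is the image of the maximal ideal.
[folklore] -/
theorem maximalIdeal_quotient_eq_map {R : Type u} [CommRing R] [IsLocalRing R] (I : Ideal R)
    [Nontrivial (R ⧸ I)] :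
    haveI := IsLocalRing.of_surjective' (Ideal.Quotient.mk I) Ideal.Quotient.mk_surjective
    maximalIdeal (R ⧸ I) = (maximalIdeal R).map (Ideal.Quotient.mk I) :=
  haveI := IsLocalRing.of_surjective' (Ideal.Quotient.mk I) Ideal.Quotient.mk_surjective
  (map_maximalIdeal_of_surjective _ Ideal.Quotient.mk_surjective).symm

end Literature.AlgebraicGeometry.Resolution

/-! ## Part II. Projective dimension over Noetherian local rings

* reduction of projective dimension modulo an `R`- and `M`-regular element (§18 Lemma 2; Lean
  proof of `hasProjectiveDimensionLE_quotSMulTop_iff` adapted from mathlib4 PR #29802, N. Guan,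
  Apache-2.0);
* minimal presentations (§19, minimal resolutions);
* depth zero + finite projective dimension ⇒ free (first step of the proof of Thm. 19.2 (II),
  cf. Thm. 19.6);
* Thm. 19.2 (I): if `𝔪` is generated by a regular sequence of length `n` then every finite module
  has projective dimension `≤ n` (here by induction on `n` via §18 Lemma 2 instead of the Koszul
  complex). -/

namespace Literature.AlgebraicGeometry.Resolution

open IsLocalRing CategoryTheory RingTheory.Sequence Pointwise
open scoped TensorProduct

universe v u

variable {R : Type u} [CommRing R]

/-- An `R`-regular element is regular on every free `R`-module. [folklore] -/
lemma IsSMulRegular.of_free {x : R} (reg : IsSMulRegular R x) (M : Type*) [AddCommGroup M]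
    [Module R M] [free : Module.Free R M] : IsSMulRegular M x := by
  rcases free with ⟨⟨I, ⟨e⟩⟩⟩
  rw [e.isSMulRegular_congr]
  apply IsSMulRegular.of_right_eq_zero_of_smul (fun y hy ↦ ?_)
  ext i
  apply reg.right_eq_zero_of_smul
  rw [← Finsupp.smul_apply, hy, Finsupp.zero_apply]

/-! ### Projective dimension is invariant under reduction modulo a regular element
(Matsumura §18 Lemma 2 (iii), in the form needed here). -/

open Ideal in
/-- **Matsumura §18 Lemma 2** (consequence of (ii): `Ext_A^n(M, N) ≅ Ext_B^n(M/xM, N)` for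
`B = A/xA`-modules `N`, when `x` is `A`-regular and `M`-regular), in the form used in the proof of
Thm. 19.2: for a finite module `M` over a Noetherian local ring `A`, `x ∈ 𝔪` both `A`- and
`M`-regular, `proj dim_A M ≤ n ↔ proj dim_{A/xA} M/xM ≤ n` (the case `n = 0` is NAK: `M/xM` free
over `A/xA` iff `M` free). Lean proof adapted from mathlib4 PR #29802 (N. Guan).
[cite: Matsumura1987, §18 Lemma 2 (PDF p. 156)] -/
lemma hasProjectiveDimensionLE_quotSMulTop_iff [Small.{v} R] [IsLocalRing R] [IsNoetherianRing R]
    (M : ModuleCat.{v} R) [Module.Finite R M] (x : R)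
    (reg1 : IsSMulRegular R x) (reg2 : IsSMulRegular M x)
    (mem : x ∈ maximalIdeal R) (n : ℕ) :
    HasProjectiveDimensionLE M n ↔
    HasProjectiveDimensionLE (ModuleCat.of (R ⧸ Ideal.span {x}) (QuotSMulTop x M)) n := by
  have : Small.{v} (R ⧸ Ideal.span {x}) := small_of_surjective Ideal.Quotient.mk_surjective
  induction n generalizing M with
  | zero =>
    simp only [HasProjectiveDimensionLE, zero_add, ← projective_iff_hasProjectiveDimensionLT_one]
    rw [← IsProjective.iff_projective, ← IsProjective.iff_projective]
    have := Module.finitePresentation_of_finite R M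
    have := Module.Finite.of_restrictScalars_finite R (R ⧸ Ideal.span {x}) (QuotSMulTop x M)
    refine ⟨fun h ↦ ?_, fun h ↦ ?_⟩
    · have := (Module.free_quotSMulTop_iff_free R M (maximalIdeal_le_jacobson _ mem) reg2).mpr
        Module.free_of_flat_of_isLocalRing
      exact Module.Projective.of_free
    · have : IsLocalRing (R ⧸ Ideal.span {x}) :=
        have : Nontrivial (R ⧸ Ideal.span {x}) :=
          Quotient.nontrivial_iff.mpr (by simpa [← Submodule.ideal_span_singleton_smul])
        IsLocalRing.of_surjective' _ Ideal.Quotient.mk_surjective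
      have := (Module.free_quotSMulTop_iff_free R M (maximalIdeal_le_jacobson _ mem) reg2).mp
        Module.free_of_flat_of_isLocalRing
      exact Module.Projective.of_free
  | succ n ih =>
    obtain ⟨N, _, _, _, _, f, surjf⟩ := Module.exists_finite_presentation R M
    let S := f.shortComplexKer
    have S_exact := LinearMap.shortExact_shortComplexKer surjf
    have proj := ModuleCat.projective_of_categoryTheory_projective S.X₂
    have reg2'' : IsSMulRegular S.X₂ x := IsSMulRegular.of_free reg1 S.X₂
    have reg2' : IsSMulRegular S.X₁ x := IsSMulRegular.submodule _ _ reg2''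
    -- reduce the presentation modulo `x`: it stays short exact because `x` is `M`-regular
    have hsurj : Function.Surjective (algebraMap R (R ⧸ Ideal.span {x})) :=
      Ideal.Quotient.mk_surjective
    let i' : QuotSMulTop x (LinearMap.ker f) →ₗ[R ⧸ Ideal.span {x}] QuotSMulTop x N :=
      (QuotSMulTop.map x (LinearMap.ker f).subtype).extendScalarsOfSurjective hsurj
    let g' : QuotSMulTop x N →ₗ[R ⧸ Ideal.span {x}] QuotSMulTop x M :=
      (QuotSMulTop.map x f).extendScalarsOfSurjective hsurj
    have Sx_exact' : Function.Exact i' g' := QuotSMulTop.map_exact x f.exact_subtype_ker_map surjf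
    have surj' : Function.Surjective g' := QuotSMulTop.map_surjective x surjf
    have inj : Function.Injective i' := by
      change Function.Injective (QuotSMulTop.map x (LinearMap.ker f).subtype)
      rw [← LinearMap.ker_eq_bot, Submodule.eq_bot_iff]
      intro y hy
      obtain ⟨y', rfl⟩ := Submodule.Quotient.mk_surjective _ y
      rw [LinearMap.mem_ker, QuotSMulTop.map_apply_mk, Submodule.Quotient.mk_eq_zero,
        Submodule.mem_smul_pointwise_iff_exists] at hy
      obtain ⟨z, _, hz⟩ := hy
      have hz' : z ∈ LinearMap.ker f := by
        have hy' := y'.2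
        rw [LinearMap.mem_ker] at hy' ⊢
        apply reg2.right_eq_zero_of_smul
        rw [← map_smul, hz]
        exact hy'
      rw [Submodule.Quotient.mk_eq_zero, Submodule.mem_smul_pointwise_iff_exists]
      exact ⟨⟨z, hz'⟩, Submodule.mem_top, Subtype.ext hz⟩
    let Sx := ModuleCat.shortComplexOfCompEqZero i' g' Sx_exact'.linearMap_comp_eq_zero
    have Sx_exact := ModuleCat.shortComplex_shortExact Sx Sx_exact' inj surj'
    have := Module.finitePresentation_of_finite R N
    exact ((S_exact.hasProjectiveDimensionLT_X₃_iff n proj).trans (ih S.X₁ reg2')).trans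
      (Sx_exact.hasProjectiveDimensionLT_X₃_iff n inferInstance).symm

/-! ### Minimal presentations over a local ring -/

section minimal

variable (R) [IsLocalRing R]

/-- **Minimal presentation** (first step of a minimal free resolution, Matsumura §19,
"Construction", PDF p. 170): a finite module `M` over a local ring `(R, 𝔪, k)` is the image of a
finite free module `L₀ = Rⁿ` under a map `ε` with `L₀ ⊗ k ≃ M ⊗ k`, i.e. `Ker ε ⊆ 𝔪 L₀` (lift a
`k`-basis of `k ⊗ M`; the lifts generate `M` by NAK).
[cite: Matsumura1987, §19, minimal resolutions (PDF p. 170)] -/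
theorem exists_linearCombination_surjective_ker_le_smul_top (M : Type*) [AddCommGroup M]
    [Module R M] [Module.Finite R M] :
    ∃ (n : ℕ) (v : Fin n → M), Function.Surjective (Finsupp.linearCombination R v) ∧
      LinearMap.ker (Finsupp.linearCombination R v) ≤
        (maximalIdeal R) • (⊤ : Submodule R (Fin n →₀ R)) := by
  let k := ResidueField R
  let b := Module.finBasis k (k ⊗[R] M)
  obtain ⟨v, hv⟩ := (TensorProduct.mk_surjective R M k Ideal.Quotient.mk_surjective).comp_left b
  refine ⟨_, v, ?_, ?_⟩
  · rw [← LinearMap.range_eq_top, Finsupp.range_linearCombination]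
    exact span_eq_top_of_tmul_eq_basis v b (fun i ↦ congr_fun hv i)
  · intro c hc
    rw [LinearMap.mem_ker, Finsupp.linearCombination_apply] at hc
    have hc' := congr_arg (TensorProduct.mk R k M 1) hc
    rw [map_finsuppSum, map_zero] at hc'
    simp only [map_smul] at hc'
    have hb : ∀ i, (TensorProduct.mk R k M 1) (v i) = b i := fun i ↦ congr_fun hv i
    have hsum : (Finsupp.linearCombination k b) (c.mapRange (residue R) (map_zero _)) = 0 := by
      rw [Finsupp.linearCombination_apply, Finsupp.sum_mapRange_index (fun _ ↦ by simp)]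
      rw [← hc']
      apply Finsupp.sum_congr
      intro i _
      rw [hb i]
      exact (algebraMap_smul k (c i) (b i)).symm
    have hzero : c.mapRange (residue R) (map_zero _) = 0 :=
      b.linearIndependent hsum
    have hci : ∀ i, c i ∈ maximalIdeal R := by
      intro i
      have := DFunLike.congr_fun hzero i
      simpa [Finsupp.mapRange_apply, residue_eq_zero_iff] using this
    rw [← c.sum_single]
    refine Submodule.sum_mem _ (fun i _ ↦ ?_)
    rw [← mul_one (c i), ← smul_eq_mul, ← Finsupp.smul_single]
    exact Submodule.smul_mem_smul (hci i) Submodule.mem_top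

/-- Minimal presentation, universe-polymorphic form: a finite free `P : Type v` and a surjection
`P → M` with kernel inside `𝔪 P`. [cite: Matsumura1987, §19, minimal resolutions (PDF p. 170)] -/
theorem exists_free_surjective_ker_le_smul_top [Small.{v} R] (M : Type v) [AddCommGroup M]
    [Module R M] [Module.Finite R M] :
    ∃ (P : Type v) (_ : AddCommGroup P) (_ : Module R P) (_ : Module.Free R P)
      (_ : Module.Finite R P) (f : P →ₗ[R] M), Function.Surjective f ∧
        LinearMap.ker f ≤ (maximalIdeal R) • (⊤ : Submodule R P) := by
  obtain ⟨n, v, surj, hker⟩ := exists_linearCombination_surjective_ker_le_smul_top R M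
  let e := Finsupp.mapRange.linearEquiv (α := Fin n) (Shrink.linearEquiv.{v} R R)
  let f := (Finsupp.linearCombination R v).comp e.toLinearMap
  refine ⟨(Fin n →₀ Shrink.{v, u} R), inferInstance, inferInstance, inferInstance, inferInstance,
    f, ?_, ?_⟩
  · simpa [f] using surj
  · intro c hc
    have hc' : e c ∈ LinearMap.ker (Finsupp.linearCombination R v) := by
      simpa [f, LinearMap.mem_ker] using hc
    have hmem := hker hc'
    have hc2 : c ∈ ((maximalIdeal R) • (⊤ : Submodule R (Fin n →₀ R))).map
        (e.symm : (Fin n →₀ R) →ₗ[R] (Fin n →₀ Shrink.{v, u} R)) :=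
      ⟨e c, hmem, e.symm_apply_apply c⟩
    rw [Submodule.map_smul''] at hc2
    exact smul_mono_right (maximalIdeal R) (le_top (a := (⊤ : Submodule R (Fin n →₀ R)).map
      (e.symm : (Fin n →₀ R) →ₗ[R] (Fin n →₀ Shrink.{v, u} R)))) hc2

end minimal

/-! ### Depth zero: finite projective dimension forces freeness
(Matsumura, proof of Thm. 19.2 (II), first step; cf. Thm. 19.6) -/

section depthzero

variable [IsLocalRing R] [IsNoetherianRing R]

omit [IsNoetherianRing R] in
/-- If `a` is killed by the maximal ideal then `a` kills `𝔪 P`. [folklore] -/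
lemma smul_eq_zero_of_mem_smul_top {a : R} (hma : ∀ r ∈ maximalIdeal R, r * a = 0)
    {P : Type*} [AddCommGroup P] [Module R P] {y : P}
    (hy : y ∈ (maximalIdeal R) • (⊤ : Submodule R P)) : a • y = 0 := by
  refine Submodule.smul_induction_on (p := fun y ↦ a • y = 0) hy ?_ ?_
  · intro r hr n _
    rw [smul_smul, mul_comm, hma r hr, zero_smul]
  · intro y z hy hz
    rw [smul_add, hy, hz, add_zero]

/-- Over a Noetherian local ring `(R, 𝔪)` with `𝔪 ∈ Ass(R)` — witnessed by `a ≠ 0` with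
`𝔪 a = 0` — a finite module of finite projective dimension is free: by induction on the projective
dimension, the kernel `K ⊆ 𝔪 L₀` of a minimal presentation is free and killed by `a`, hence zero.
This is the argument "`L_r ⊂ 𝔪 L_{r-1}`, but then `a L_r = 0`" of the proof of Thm. 19.2 (II)
(cf. Thm. 19.6 and the Remark after it). [cite: Matsumura1987, Thm. 19.2 (proof, (II)); Thm. 19.6] -/
theorem free_of_hasProjectiveDimensionLE_of_smul_eq_zero [Small.{v} R] {a : R} (ha : a ≠ 0)
    (hma : ∀ r ∈ maximalIdeal R, r * a = 0) (n : ℕ) :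
    ∀ (M : ModuleCat.{v} R), Module.Finite R M → HasProjectiveDimensionLE M n →
      Module.Free R M := by
  induction n with
  | zero =>
    intro M _ hM
    have : Projective M := by
      simp only [HasProjectiveDimensionLE, zero_add] at hM
      exact projective_iff_hasProjectiveDimensionLT_one.mpr hM
    have : Module.Projective R M := M.projective_of_module_projective
    exact Module.free_of_flat_of_isLocalRing
  | succ n ih =>
    intro M _ hM
    obtain ⟨P, _, _, _, _, f, surjf, hker⟩ := exists_free_surjective_ker_le_smul_top R M
    let S := f.shortComplexKer
    have S_exact : S.ShortExact := LinearMap.shortExact_shortComplexKer surjf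
    have proj : Projective S.X₂ := ModuleCat.projective_of_categoryTheory_projective S.X₂
    have hK : HasProjectiveDimensionLE S.X₁ n :=
      (S_exact.hasProjectiveDimensionLT_X₃_iff n proj).mp hM
    have freeK : Module.Free R (LinearMap.ker f) := ih S.X₁ inferInstance hK
    -- the kernel is free and killed by `a ≠ 0`, hence zero
    have kerbot : LinearMap.ker f = ⊥ := by
      by_contra hne
      have : Nontrivial (LinearMap.ker f) := Submodule.nontrivial_iff_ne_bot.mpr hne
      let B := Module.Free.chooseBasis R (LinearMap.ker f)
      obtain ⟨i⟩ := B.index_nonempty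
      have hzero : a • B i = 0 := by
        apply Subtype.val_injective
        simp only [SetLike.val_smul, ZeroMemClass.coe_zero]
        exact smul_eq_zero_of_mem_smul_top hma (hker (B i).2)
      have := congr_arg (fun m ↦ B.repr m i) hzero
      simp at this
      exact ha this
    have bij : Function.Bijective f := ⟨LinearMap.ker_eq_bot.mp kerbot, surjf⟩
    exact Module.Free.of_equiv (LinearEquiv.ofBijective f bij)

/-- Under the same depth-zero hypothesis, if `𝔪` has finite projective dimension then `𝔪 = 0`
(`𝔪` is then free and killed by `a ≠ 0`). [cite: Matsumura1987, Thm. 19.2 (proof, (II))] -/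
theorem maximalIdeal_eq_bot_of_hasProjectiveDimensionLE_of_smul_eq_zero [Small.{v} R] {a : R}
    (ha : a ≠ 0) (hma : ∀ r ∈ maximalIdeal R, r * a = 0) {n : ℕ}
    (h : HasProjectiveDimensionLE (ModuleCat.of R (Shrink.{v} (maximalIdeal R))) n) :
    maximalIdeal R = ⊥ := by
  have free : Module.Free R (Shrink.{v} (maximalIdeal R)) :=
    free_of_hasProjectiveDimensionLE_of_smul_eq_zero ha hma n
      (ModuleCat.of R (Shrink.{v} (maximalIdeal R)))
      (Module.Finite.equiv (Shrink.linearEquiv.{v} R (maximalIdeal R)).symm) h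
  have free' : Module.Free R (maximalIdeal R) :=
    Module.Free.of_equiv (Shrink.linearEquiv.{v} R (maximalIdeal R))
  by_contra hne
  have : Nontrivial (maximalIdeal R) := Submodule.nontrivial_iff_ne_bot.mpr hne
  let B := Module.Free.chooseBasis R (maximalIdeal R)
  obtain ⟨i⟩ := B.index_nonempty
  have hzero : a • B i = 0 := by
    apply Subtype.val_injective
    simp only [SetLike.val_smul, ZeroMemClass.coe_zero, smul_eq_mul, mul_comm a]
    exact hma _ (B i).2
  have := congr_arg (fun m ↦ B.repr m i) hzero
  simp at this
  exact ha this

end depthzero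

/-! ### Rings whose maximal ideal is generated by a regular sequence have finite global dimension
(Matsumura Thm. 19.2, (I)) -/

section forward

/-- **Matsumura Thm. 19.2, (I)** ("regular ⇒ `gl dim A = dim A`", upper bound): if the maximal
ideal of a Noetherian local ring `A` is generated by an `A`-sequence `x₁, …, xₙ`, then every finite
`A`-module has projective dimension `≤ n`. (The book uses the Koszul complex as a minimal
resolution of `k` and §19 Lemma 1; here: induction on `n`, passing to `A/x₁A` with §18 Lemma 2
applied to a first syzygy of `M`.) [cite: Matsumura1987, Thm. 19.2] -/
theorem hasProjectiveDimensionLE_of_maximalIdeal_eq_ofList (n : ℕ) :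
    ∀ (R : Type u) [CommRing R] [IsLocalRing R] [IsNoetherianRing R] [Small.{v} R]
      (rs : List R), IsWeaklyRegular R rs → Ideal.ofList rs = maximalIdeal R → rs.length = n →
      ∀ (M : ModuleCat.{v} R), Module.Finite R M → HasProjectiveDimensionLE M n := by
  induction n with
  | zero =>
    intro R _ _ _ _ rs reg span len M _
    have hrs : rs = [] := List.length_eq_zero_iff.mp len
    subst hrs
    have hbot : maximalIdeal R = ⊥ := by simpa using span.symm
    -- a minimal presentation is then an isomorphism
    obtain ⟨P, _, _, _, _, f, surjf, hker⟩ := exists_free_surjective_ker_le_smul_top R M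
    have kerbot : LinearMap.ker f = ⊥ := by
      rw [eq_bot_iff]
      refine hker.trans ?_
      simp [hbot]
    have bij : Function.Bijective f := ⟨LinearMap.ker_eq_bot.mp kerbot, surjf⟩
    have : Module.Free R M := Module.Free.of_equiv (LinearEquiv.ofBijective f bij)
    simp only [HasProjectiveDimensionLE, zero_add]
    infer_instance
  | succ n ih =>
    intro R _ _ _ _ rs reg span len M _
    match rs with
    | [] => simp at len
    | x :: rs' =>
      simp only [List.length_cons, Nat.add_right_cancel_iff] at len
      obtain ⟨xreg, reg'⟩ := (isWeaklyRegular_cons_iff R x rs').mp reg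
      have xmem : x ∈ maximalIdeal R := by
        rw [← span]
        exact Ideal.subset_span (by simp)
      let R' := R ⧸ Ideal.span {x}
      have hne : Ideal.span {x} ≠ ⊤ := by
        intro h
        rw [Ideal.span_singleton_eq_top] at h
        exact xmem h
      have : Nontrivial R' := Ideal.Quotient.nontrivial_iff.mpr hne
      have : IsNoetherianRing R' := inferInstanceAs (IsNoetherianRing (R ⧸ Ideal.span {x}))
      have : IsLocalRing R' := IsLocalRing.of_surjective' _ Ideal.Quotient.mk_surjective
      have : IsLocalHom (Ideal.Quotient.mk (Ideal.span {x})) :=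
        IsLocalHom.of_surjective _ Ideal.Quotient.mk_surjective
      have : Small.{v} R' := small_of_surjective Ideal.Quotient.mk_surjective
      -- the tail is a weakly regular sequence on `R'` generating its maximal ideal
      let e : QuotSMulTop x R ≃ₗ[R] R' :=
        Submodule.quotEquivOfEq _ _ (by simp [← Submodule.ideal_span_singleton_smul])
      have reg'' : IsWeaklyRegular R' rs' := (e.isWeaklyRegular_congr rs').mp reg'
      have regR' : IsWeaklyRegular R' (rs'.map (algebraMap R R')) :=
        (isWeaklyRegular_map_algebraMap_iff R' R' rs').mpr reg''
      have h1 : (maximalIdeal R).map (Ideal.Quotient.mk (Ideal.span {x})) = maximalIdeal R' := by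
        rw [← maximalIdeal_comap (Ideal.Quotient.mk (Ideal.span {x})),
          Ideal.map_comap_of_surjective _ Ideal.Quotient.mk_surjective]
      have span' : Ideal.ofList (rs'.map (algebraMap R R')) = maximalIdeal R' := by
        rw [← Ideal.map_ofList, Ideal.Quotient.algebraMap_eq, ← h1, ← span, Ideal.ofList_cons,
          Ideal.map_sup, Ideal.map_quotient_self, bot_sup_eq]
      have len' : (rs'.map (algebraMap R R')).length = n := by simp [len]
      -- a presentation of `M`
      obtain ⟨P, _, _, _, _, f, surjf⟩ := Module.exists_finite_presentation R M
      let S := f.shortComplexKer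
      have S_exact : S.ShortExact := LinearMap.shortExact_shortComplexKer surjf
      have proj : Projective S.X₂ := ModuleCat.projective_of_categoryTheory_projective S.X₂
      have xregP : IsSMulRegular P x := IsSMulRegular.of_free xreg P
      have xregK : IsSMulRegular S.X₁ x := IsSMulRegular.submodule _ _ xregP
      have hK : HasProjectiveDimensionLE S.X₁ n := by
        rw [hasProjectiveDimensionLE_quotSMulTop_iff S.X₁ x xreg xregK xmem n]
        have : Module.Finite R' (QuotSMulTop x S.X₁) :=
          Module.Finite.of_restrictScalars_finite R _ _
        exact ih R' (rs'.map (algebraMap R R')) regR' span' len'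
          (ModuleCat.of R' (QuotSMulTop x S.X₁)) this
      exact (S_exact.hasProjectiveDimensionLT_X₃_iff n proj).mpr hK

/-- Thm. 19.2 (I), packaged: if `𝔪` is generated by an `A`-sequence `rs` then every finite module
has projective dimension `≤ rs.length`. [cite: Matsumura1987, Thm. 19.2] -/
theorem hasProjectiveDimensionLE_length_of_isWeaklyRegular [IsLocalRing R] [IsNoetherianRing R]
    [Small.{v} R] {rs : List R} (reg : IsWeaklyRegular R rs)
    (span : Ideal.ofList rs = maximalIdeal R) (M : ModuleCat.{v} R) [Module.Finite R M] :
    HasProjectiveDimensionLE M rs.length :=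
  hasProjectiveDimensionLE_of_maximalIdeal_eq_ofList rs.length R rs reg span rfl M ‹_›

end forward

end Literature.AlgebraicGeometry.Resolution

/-! ## Part III. Serre's theorem (Thm. 19.2, (iii) ⇒ (i)) and Thm. 19.3

Lean proofs of `exist_isSMulRegular_of_exist_hasProjectiveDimensionLE`,
`spanFinrank_maximalIdeal_quotient` and `generate_by_regular(_aux)` are adapted from mathlib4 PR
#29802 (N. Guan, Apache-2.0), with its Auslander–Buchsbaum step replaced by the depth-zero argument
of Matsumura's own proof (Part II). -/

namespace Literature.AlgebraicGeometry.Resolution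

open IsLocalRing CategoryTheory RingTheory.Sequence

universe v u

variable {R : Type u} [CommRing R]

/-- First step of the proof of Thm. 19.2 (II): if `𝔪 ≠ 0` has finite projective dimension then
`𝔪 ∉ Ass(A)`, i.e. (prime avoidance over the finitely many associated primes) `𝔪` contains an
`A`-regular element. [cite: Matsumura1987, Thm. 19.2 (proof, (II))] -/
lemma exist_isSMulRegular_of_exist_hasProjectiveDimensionLE_aux [IsLocalRing R]
    [IsNoetherianRing R] [Small.{v} R] (nebot : maximalIdeal R ≠ ⊥)
    (h : ∃ n, HasProjectiveDimensionLE (ModuleCat.of R (Shrink.{v} (maximalIdeal R))) n) :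
    ∃ x ∈ maximalIdeal R, IsSMulRegular R x := by
  by_contra! hreg
  have hsub : (maximalIdeal R : Set R) ⊆ ⋃ p ∈ associatedPrimes R R, p := by
    intro x hx
    have : x ∉ {r : R | IsSMulRegular R r} := hreg x hx
    rwa [← Set.mem_compl_iff, ← biUnion_associatedPrimes_eq_compl_regular R R] at this
  have fin := associatedPrimes.finite R R
  obtain ⟨p, hp, hle⟩ := (Ideal.subset_union_prime_finite fin (f := fun I : Ideal R ↦ I) ⊤ ⊤
    (fun I hI _ _ ↦ IsAssociatedPrime.isPrime hI)).mp hsub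
  have hpeq : maximalIdeal R = p :=
    (maximalIdeal.isMaximal R).eq_of_le (IsAssociatedPrime.isPrime hp).ne_top hle
  obtain ⟨a, ha⟩ := ((isAssociatedPrime_iff).mp hp).2
  have hma : ∀ r ∈ maximalIdeal R, r * a = 0 := by
    intro r hr
    rw [hpeq, ha, Submodule.mem_colon_singleton, Submodule.mem_bot] at hr
    simpa using hr
  have ha0 : a ≠ 0 := by
    rintro rfl
    apply (maximalIdeal.isMaximal R).ne_top
    rw [hpeq, ha, eq_top_iff]
    intro r _
    simp [Submodule.mem_colon_singleton]
  rcases h with ⟨n, hn⟩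
  exact nebot (maximalIdeal_eq_bot_of_hasProjectiveDimensionLE_of_smul_eq_zero ha0 hma hn)

/-- Proof of Thm. 19.2 (II), choice of `x`: if `𝔪 ≠ 0` has finite projective dimension then "we
can choose `x ∈ 𝔪` not contained in `𝔪²` or in any associated prime of `A`", so `x` is
`A`-regular. [cite: Matsumura1987, Thm. 19.2 (proof, (II))] -/
lemma exist_isSMulRegular_of_exist_hasProjectiveDimensionLE [IsLocalRing R] [IsNoetherianRing R]
    [Small.{v} R] (nebot : maximalIdeal R ≠ ⊥)
    (h : ∃ n, HasProjectiveDimensionLE (ModuleCat.of R (Shrink.{v} (maximalIdeal R))) n) :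
    ∃ x ∈ maximalIdeal R, x ∉ maximalIdeal R ^ 2 ∧ IsSMulRegular R x := by
  --use prime avoidance to `m²` and associated primes of `R`
  obtain ⟨x, xmem, xnmem⟩ : ∃ x ∈ maximalIdeal R,
    x ∉ ⋃ I ∈ {(maximalIdeal R) ^ 2} ∪ associatedPrimes R R, I := by
    by_contra! h'
    have lt := (maximalIdeal_sq_lt_maximalIdeal R).mpr (isField_iff_maximalIdeal_eq.not.mpr nebot)
    have fin := (associatedPrimes.finite R R).insert ((maximalIdeal R) ^ 2)
    absurd (Ideal.subset_iUnion_iff_mem_of_isMaximal_of_finite fin _ _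
      (fun I hI ne _ ↦ (Set.mem_of_mem_insert_of_ne hI ne).isPrime) lt.ne_top lt.ne_top).mp h'
    simp only [Set.mem_insert_iff, lt.ne.symm, false_or]
    by_contra ass
    absurd exist_isSMulRegular_of_exist_hasProjectiveDimensionLE_aux nebot h
    simp only [not_exists, not_and]
    intro x hx
    have : x ∈ {r : R | IsSMulRegular R r}ᶜ := by
      simpa [← biUnion_associatedPrimes_eq_compl_regular] using Set.mem_biUnion ass hx
    exact this
  simp only [Set.singleton_union, Set.mem_insert_iff, Set.iUnion_iUnion_eq_or_left, Set.mem_union,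
    SetLike.mem_coe, Set.mem_iUnion, exists_prop, not_or, not_exists, not_and] at xnmem
  use x
  have : x ∈ {r : R | IsSMulRegular R r} := by
    rw [← Set.not_notMem, ← Set.mem_compl_iff, ← biUnion_associatedPrimes_eq_compl_regular]
    simpa using xnmem.2
  simpa [xmem, xnmem.1]

/-- For `x ∈ 𝔪 ∖ 𝔪²` in a Noetherian local ring, `emb dim A/xA = emb dim A - 1`. [folklore] -/
lemma spanFinrank_maximalIdeal_quotient [IsLocalRing R] [IsNoetherianRing R] (x : R)
    (mem : x ∈ maximalIdeal R) (nmem : x ∉ (maximalIdeal R) ^ 2) :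
    haveI : IsLocalRing (R ⧸ Ideal.span {x}) :=
      haveI : Nontrivial (R ⧸ Ideal.span {x}) :=
        Ideal.Quotient.nontrivial_iff.mpr (by simpa [← Submodule.ideal_span_singleton_smul])
      IsLocalRing.of_surjective' (Ideal.Quotient.mk (Ideal.span {x})) Ideal.Quotient.mk_surjective
    (maximalIdeal (R ⧸ Ideal.span {x})).spanFinrank = (maximalIdeal R).spanFinrank - 1 := by
  have : Nontrivial (R ⧸ Ideal.span {x}) := Ideal.Quotient.nontrivial_iff.mpr
    (by simpa [← Submodule.ideal_span_singleton_smul] using mem)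
  have : IsLocalHom (Ideal.Quotient.mk (Ideal.span {x})) :=
    IsLocalHom.of_surjective _ Ideal.Quotient.mk_surjective
  have : IsLocalRing (R ⧸ Ideal.span {x}) :=
    IsLocalRing.of_surjective _ Ideal.Quotient.mk_surjective
  have addeq : _ + Module.finrank (ResidueField R) (Submodule.span (ResidueField R)
    ((maximalIdeal R).toCotangent '' (Submodule.comap (maximalIdeal R).subtype
      (RingHom.ker (Ideal.Quotient.mk (Ideal.span {x}))) : Set (maximalIdeal R)))) = _ :=
    spanFinrank_maximalIdeal_add_finrank_eq_of_surjective Ideal.Quotient.mk_surjective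
  have eq' : Ideal.span {x} = (Submodule.span R {⟨x, mem⟩}).map (maximalIdeal R).subtype := by simp
  have eq : Submodule.comap (maximalIdeal R).subtype (Ideal.span {x}) =
    Submodule.span R {⟨x, mem⟩} := by
    rw [eq', Submodule.comap_map_eq_of_injective (maximalIdeal R).subtype_injective]
  have : (maximalIdeal R).toCotangent ⟨x, mem⟩ ≠ 0 := by simpa [Ideal.toCotangent_eq_zero]
  rw [← addeq, Ideal.mk_ker, eq, ← Submodule.map_coe, Submodule.map_span,
    Submodule.span_span_of_tower R, Set.image_singleton, finrank_span_singleton this,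
    Nat.add_sub_cancel_right]

open Pointwise in
/-- **Proof of Thm. 19.2 (II)**, induction on `s = emb dim A`: if `𝔪` has finite projective
dimension then `𝔪` is generated by an `A`-sequence of length `emb dim A`. Step: choose an
`A`-regular `x ∈ 𝔪 ∖ 𝔪²`; with `B = A/xA`, `proj dim_B 𝔪/x𝔪 < ∞` (§18 Lemma 2) and the natural
map `𝔪/x𝔪 → 𝔪/xA` splits ("`𝔟 ∩ xA ⊂ x𝔪`" for `𝔟 = (x₂, …, x_s)`), so the maximal ideal `𝔪/xA`
of `B` is a direct summand of `𝔪/x𝔪` and has finite projective dimension; induct.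
[cite: Matsumura1987, Thm. 19.2 (proof, (II))] -/
theorem generate_by_regular_aux [IsLocalRing R] [IsNoetherianRing R] [Small.{v} R]
    (h : ∃ n, HasProjectiveDimensionLE (ModuleCat.of R (Shrink.{v} (maximalIdeal R))) n)
    (n : ℕ) : Submodule.spanFinrank (maximalIdeal R) = n →
    ∃ rs : List R, IsRegular R rs ∧ Ideal.ofList rs = maximalIdeal R := by
  induction n generalizing R with
  | zero =>
    intro hrank
    have : (maximalIdeal R) = ⊥ := by
      simp [← Submodule.spanRank_eq_zero_iff_eq_bot, hrank,
        Submodule.fg_iff_spanRank_eq_spanFinrank.mpr (maximalIdeal R).fg_of_isNoetherianRing]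
    use []
    simpa [this] using RingTheory.Sequence.IsRegular.nil R R
  | succ n ih =>
    have fg : (maximalIdeal R).FG := (maximalIdeal R).fg_of_isNoetherianRing
    intro hrank
    have nebot : maximalIdeal R ≠ ⊥ := by
      simp [← Submodule.spanRank_eq_zero_iff_eq_bot, hrank,
        Submodule.fg_iff_spanRank_eq_spanFinrank.mpr fg]
    rcases exist_isSMulRegular_of_exist_hasProjectiveDimensionLE nebot h with ⟨x, mem, nmem, xreg⟩
    let R' := R ⧸ Ideal.span {x}
    have : Nontrivial (R ⧸ Ideal.span {x}) := Ideal.Quotient.nontrivial_iff.mpr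
      (by simpa [← Submodule.ideal_span_singleton_smul] using mem)
    have : IsLocalHom (Ideal.Quotient.mk (Ideal.span {x})) :=
      IsLocalHom.of_surjective _ Ideal.Quotient.mk_surjective
    have : IsLocalRing (R ⧸ Ideal.span {x}) :=
      IsLocalRing.of_surjective _ Ideal.Quotient.mk_surjective
    let xm' := (Submodule.span (ResidueField R) {(maximalIdeal R).toCotangent ⟨x, mem⟩})
    rcases xm'.exists_isCompl with ⟨J', ⟨inf, sup⟩⟩
    let g : (maximalIdeal R) →ₛₗ[residue R] (maximalIdeal R).Cotangent := {
      __ := (maximalIdeal R).toCotangent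
      map_smul' r m := map_smul (maximalIdeal R).toCotangent r m }
    have surjg : Function.Surjective g := (maximalIdeal R).toCotangent_surjective
    have supeq : (J'.comap g) ⊔ Submodule.span R {⟨x, mem⟩} = ⊤ := by
      have : RingHomSurjective (residue R) := ⟨residue_surjective⟩
      rw [sup_comm, ← sup_eq_left.mpr (LinearMap.ker_le_comap g), ← sup_assoc,
        ← Submodule.comap_map_eq, Submodule.map_sup, Submodule.map_span,
        Submodule.map_comap_eq_of_surjective surjg, Set.image_singleton,
        ← Submodule.comap_top g, ← codisjoint_iff.mp sup]
      simp [xm', g]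
    have infle : (J'.comap g) ⊓ Submodule.span R {⟨x, mem⟩} ≤
      x • (⊤ : Submodule R (maximalIdeal R)) := by
      intro y hy
      simp only [Submodule.mem_inf, Submodule.mem_comap] at hy
      rcases Submodule.mem_span_singleton.mp hy.2 with ⟨r, hr⟩
      rw [← hr, LinearMap.map_smulₛₗ] at hy
      simp only [SetLike.mk_smul_mk, smul_eq_mul, g] at hy
      have := Submodule.mem_inf.mpr ⟨Submodule.mem_span_singleton.mpr (by use (residue R) r), hy.1⟩
      erw [disjoint_iff.mp inf, Submodule.mem_bot] at this
      have eq0 : r ∈ maximalIdeal R := (residue_eq_zero_iff _).mp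
        ((smul_eq_zero_iff_left (by simpa [Ideal.toCotangent_eq_zero] using nmem)).mp this)
      simp only [SetLike.mk_smul_mk, smul_eq_mul, ← Subtype.val_inj] at hr
      have : y = x • ⟨r, eq0⟩ := by simpa [← Subtype.val_inj, mul_comm x r] using hr.symm
      simpa [this] using Submodule.smul_mem_pointwise_smul (⟨r, eq0⟩ : maximalIdeal R) x ⊤ trivial
    let f : maximalIdeal R →ₗ[R] maximalIdeal R' := {
      toFun m := ⟨Ideal.Quotient.mk (Ideal.span {x}) m,
        map_nonunit (Ideal.Quotient.mk (Ideal.span {x})) m.1 m.2⟩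
      map_add' a b := by simp
      map_smul' r a := by simp [Algebra.smul_def, R']}
    have surjf : Function.Surjective f := by
      intro y
      rcases Ideal.Quotient.mk_surjective y.1 with ⟨z, hz⟩
      have : z ∈ maximalIdeal R := by
        simp [← maximalIdeal_comap (Ideal.Quotient.mk (Ideal.span {x})), hz]
      use ⟨z, this⟩
      simp [f, hz]
    have kerf : LinearMap.ker f = Submodule.span R {⟨x, mem⟩} := by
      ext y
      simp only [LinearMap.mem_ker, LinearMap.coe_mk, AddHom.coe_mk, Submodule.mk_eq_zero, f]
      rw [Ideal.Quotient.eq_zero_iff_mem, ← Submodule.comap_map_eq_of_injective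
        (maximalIdeal R).subtype_injective (Submodule.span R {⟨x, mem⟩})]
      simp
    let e1' := (Shrink.linearEquiv.{v} R (maximalIdeal R')).symm.toLinearMap.comp
      (f.comp ((J'.comap g) ⊔ (Submodule.span R {⟨x, mem⟩})).subtype)
    have surje1' : Function.Surjective e1' := by
      simp only [LinearMap.coe_comp, LinearEquiv.coe_coe, Submodule.coe_subtype,
        EquivLike.comp_surjective, e1']
      apply surjf.comp
      intro y
      use ⟨y, by simp [supeq]⟩
    let e1 : Shrink.{v, u} (maximalIdeal R') ≃ₗ[R] ↥((J'.comap g) ⊔ (Submodule.span R {⟨x, mem⟩})) ⧸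
      (Submodule.span R {⟨x, mem⟩}).comap ((J'.comap g) ⊔ Submodule.span R {⟨x, mem⟩}).subtype :=
      ((Submodule.quotEquivOfEq _ _ (by simp [e1', LinearMap.ker_comp, kerf])).trans
      (LinearMap.quotKerEquivOfSurjective _ surje1')).symm
    let e2 := LinearMap.quotientInfEquivSupQuotient (J'.comap g) (Submodule.span R {⟨x, mem⟩})
    let i3 : ((J'.comap g) ⧸ (J'.comap g).comap (J'.comap g).subtype  ⊓
      Submodule.comap (J'.comap g).subtype (Submodule.span R {⟨x, mem⟩})) →ₗ[R]
      QuotSMulTop x (Shrink.{v} (maximalIdeal R)) :=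
      Submodule.mapQ _ _ ((Shrink.linearEquiv.{v} R (maximalIdeal R)).symm.toLinearMap.comp
        (J'.comap g).subtype) (by
          rw [← Submodule.comap_inf, Submodule.comap_comp]
          apply Submodule.comap_mono (le_trans infle (fun y hy ↦ ?_))
          rcases (Submodule.mem_smul_pointwise_iff_exists _ _ _).mp hy with ⟨z, _, hz⟩
          simp only [Submodule.mem_comap, ← hz, map_smul]
          exact Submodule.smul_mem_pointwise_smul _ x ⊤ trivial)
    let i' : Shrink.{v} (maximalIdeal R') →ₗ[R] QuotSMulTop x (Shrink.{v} (maximalIdeal R)) :=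
      i3.comp (e1.trans e2.symm).toLinearMap
    let r' : QuotSMulTop x (Shrink.{v} (maximalIdeal R)) →ₗ[R] Shrink.{v} (maximalIdeal R') :=
      Submodule.liftQ _ ((Shrink.linearEquiv.{v} R (maximalIdeal R')).symm.toLinearMap.comp
      (f.comp (Shrink.linearEquiv.{v} R (maximalIdeal R)).toLinearMap)) (fun y hy ↦ by
      rcases (Submodule.mem_smul_pointwise_iff_exists _ _ _).mp hy with ⟨z, _, hz⟩
      simp [← hz, f, Algebra.smul_def, R'])
    have compid : r'.comp i' = LinearMap.id := by
      ext y
      simp only [LinearMap.coe_comp, LinearEquiv.coe_coe, Function.comp_apply,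
        LinearEquiv.trans_apply, LinearMap.id_coe, id_eq, SetLike.coe_eq_coe,
        EmbeddingLike.apply_eq_iff_eq, i']
      rcases Submodule.Quotient.mk_surjective _ (e2.symm (e1 y)) with ⟨z, hz⟩
      have : e1.symm (e2 (e2.symm (e1 y))) = y := by simp
      apply Eq.trans _ this
      simp only [← hz, Submodule.mapQ_apply, LinearMap.coe_comp, LinearEquiv.coe_coe,
        Submodule.coe_subtype, Function.comp_apply, i3, Submodule.liftQ_apply, LinearMap.coe_comp,
        LinearEquiv.coe_coe, Function.comp_apply, r', e2,
        LinearMap.quotientInfEquivSupQuotient_apply_mk]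
      simp [e1, e1']
    have : IsScalarTower R (R ⧸ Ideal.span {x}) (Shrink.{v} (maximalIdeal R')) :=
      (equivShrink (maximalIdeal R')).symm.isScalarTower R _
    let r := r'.extendScalarsOfSurjective (Ideal.Quotient.mk_surjective (I := Ideal.span {x}))
    let i := i'.extendScalarsOfSurjective (Ideal.Quotient.mk_surjective (I := Ideal.span {x}))
    have compid' : r.comp i = LinearMap.id := by
      apply LinearMap.ext (fun y ↦ ?_)
      exact LinearMap.ext_iff.mp compid y
    have retr  : Retract (ModuleCat.of (R ⧸ Ideal.span {x}) (Shrink.{v} (maximalIdeal R')))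
      (ModuleCat.of (R ⧸ Ideal.span {x}) (QuotSMulTop x (Shrink.{v} (maximalIdeal R)))) := {
      i := ModuleCat.ofHom i
      r := ModuleCat.ofHom r
      retract := by rw [← ModuleCat.ofHom_comp, compid', ModuleCat.ofHom_id]}
    have fin : ∃ n, HasProjectiveDimensionLE
      (ModuleCat.of R' (Shrink.{v, u} (maximalIdeal R'))) n := by
      rcases h with ⟨n, hn⟩
      have xreg' : IsSMulRegular (Shrink.{v} (maximalIdeal R)) x :=
        ((Shrink.linearEquiv.{v} R (maximalIdeal R)).isSMulRegular_congr x).mpr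
          (IsSMulRegular.submodule _ x xreg)
      have : Module.Finite R (Shrink.{v} (maximalIdeal R)) :=
        Module.Finite.equiv (Shrink.linearEquiv.{v} R (maximalIdeal R)).symm
      rw [hasProjectiveDimensionLE_quotSMulTop_iff
        (ModuleCat.of R (Shrink.{v} (maximalIdeal R))) x xreg xreg' mem] at hn
      use n
      exact retr.hasProjectiveDimensionLT (n + 1)
    have rank : Submodule.spanFinrank (maximalIdeal R') = n := by
      rw [spanFinrank_maximalIdeal_quotient x mem nmem, hrank, Nat.add_sub_cancel]
    have : Small.{v} R' := small_of_surjective Ideal.Quotient.mk_surjective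
    rcases ih fin rank with ⟨rs', reg, span⟩
    rcases List.map_surjective_iff.mpr Ideal.Quotient.mk_surjective rs' with ⟨rs, hrs⟩
    use x :: rs
    have eq : Ideal.span {x} ⊔ Ideal.ofList rs = maximalIdeal R := by
      rw [← Ideal.mk_ker (I := Ideal.span {x}), sup_comm,
        ← Ideal.comap_map_of_surjective' _ Ideal.Quotient.mk_surjective,
        Ideal.map_ofList, hrs, span, maximalIdeal_comap (Ideal.Quotient.mk (Ideal.span {x}))]
    simp only [isRegular_cons_iff, xreg, true_and, Ideal.ofList_cons, eq, and_true]
    let e : QuotSMulTop x R ≃ₗ[R] (R ⧸ Ideal.span {x}) :=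
      Submodule.quotEquivOfEq _ _ (by simp [← Submodule.ideal_span_singleton_smul])
    rw [e.isRegular_congr]
    constructor
    · rw [← RingTheory.Sequence.isWeaklyRegular_map_algebraMap_iff (R ⧸ Ideal.span {x})]
      simpa [hrs] using reg.1
    · have : Ideal.ofList rs ≤ maximalIdeal R := by simp [← eq]
      apply (ne_top_of_le_ne_top _ (Submodule.smul_mono_left this)).symm
      simp only [Ideal.smul_top_eq_map, Ideal.Quotient.algebraMap_eq, ne_eq,
        Submodule.restrictScalars_eq_top_iff]
      have : Ideal.map (Ideal.Quotient.mk (Ideal.span {x})) (maximalIdeal R) ≤ maximalIdeal R' := by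
        rw [Ideal.map_le_iff_le_comap, maximalIdeal_comap (Ideal.Quotient.mk (Ideal.span {x}))]
      exact ne_top_of_le_ne_top Ideal.IsPrime.ne_top' this

/-- If the maximal ideal of a Noetherian local ring has finite projective dimension then it is
generated by an `A`-sequence. [cite: Matsumura1987, Thm. 19.2 (proof, (II))] -/
theorem generate_by_regular [IsLocalRing R] [IsNoetherianRing R] [Small.{v} R]
    (h : ∃ n, HasProjectiveDimensionLE (ModuleCat.of R (Shrink.{v} (maximalIdeal R))) n) :
    ∃ rs : List R, IsRegular R rs ∧ Ideal.ofList rs = maximalIdeal R :=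
  generate_by_regular_aux h (Submodule.spanFinrank (maximalIdeal R)) rfl

/-- **Matsumura Thm. 19.2 (Serre), (iii) ⇒ (i)** in the form actually established by the printed
proof: a Noetherian local ring `A` whose maximal ideal has finite projective dimension
(equivalently `gl dim A = proj dim_A k < ∞`) is regular — `𝔪` is generated by an `A`-sequence of
length `≤ dim A`, so `emb dim A ≤ dim A`. [cite: Matsumura1987, Thm. 19.2] -/
theorem IsRegularLocalRing.of_maximalIdeal_hasProjectiveDimensionLE
    [IsLocalRing R] [IsNoetherianRing R] [Small.{v} R]
    (h : ∃ n, HasProjectiveDimensionLE (ModuleCat.of R (Shrink.{v} (maximalIdeal R))) n) :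
    IsRegularLocalRing R := by
  classical
  rcases generate_by_regular h with ⟨rs, reg, span⟩
  apply IsRegularLocalRing.of_spanFinrank_maximalIdeal_le
  have spaneq : Ideal.span (rs.toFinset : Set R) = maximalIdeal R := by simp [← span]
  nth_rw 1 [← spaneq]
  apply le_trans (Nat.cast_le.mpr
    (Submodule.spanFinrank_span_le_ncard_of_finite rs.toFinset.finite_toSet))
  rw [Set.ncard_coe_finset rs.toFinset]
  apply le_trans (Nat.cast_le.mpr rs.toFinset_card_le)
  have hdim := ringKrullDim_add_length_eq_ringKrullDim_of_isRegular rs reg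
  rw [span, ringKrullDim_eq_zero_of_isField
    ((Ideal.Quotient.maximal_ideal_iff_isField_quotient (maximalIdeal R)).mp inferInstance),
    zero_add] at hdim
  exact hdim.le

/-! ### Localisation (Matsumura Thm. 19.3) -/

/-- Proof of Thm. 19.3: "`L. ⊗_A A_P` is a projective resolution of `(A/P) ⊗ A_P`" — here for the
`A`-module `P` itself, whose localisation at `P` is the maximal ideal `P A_P`: hence
`proj dim_{A_P} P A_P ≤ proj dim_A P`. [cite: Matsumura1987, Thm. 19.3 (proof)] -/
theorem hasProjectiveDimensionLE_maximalIdeal_localization (p : Ideal R) [p.IsPrime] (n : ℕ)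
    (h : HasProjectiveDimensionLE (ModuleCat.of R p) n) :
    HasProjectiveDimensionLE (ModuleCat.of (Localization.AtPrime p)
      (maximalIdeal (Localization.AtPrime p))) n := by
  let Rp := Localization.AtPrime p
  let M := ModuleCat.of R p
  have h1 : HasProjectiveDimensionLE (M.localizedModule p.primeCompl) n :=
    ModuleCat.localizedModule_hasProjectiveDimensionLE n p.primeCompl M
  let g := Submodule.toLocalized' Rp p.primeCompl (Algebra.linearMap R Rp) p
  have : IsLocalizedModule p.primeCompl (M.localizedModuleMkLinearMap p.primeCompl) :=
    ModuleCat.localizedModule_isLocalizedModule M p.primeCompl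
  let e₁ := IsLocalizedModule.linearEquiv p.primeCompl (M.localizedModuleMkLinearMap p.primeCompl) g
  let e₂ := LinearEquiv.extendScalarsOfIsLocalization p.primeCompl Rp e₁
  have heq : Submodule.localized' Rp p.primeCompl (Algebra.linearMap R Rp) p = maximalIdeal Rp := by
    rw [Submodule.localized'_eq_span, ← Localization.AtPrime.map_eq_maximalIdeal]
    rfl
  let e₃ : Submodule.localized' Rp p.primeCompl (Algebra.linearMap R Rp) p ≃ₗ[Rp] maximalIdeal Rp :=
    LinearEquiv.ofEq _ _ heq
  exact hasProjectiveDimensionLT_of_iso (e₂.trans e₃).toModuleIso (n + 1)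

/-- **Matsumura Thm. 19.3 (Serre).** "Let `A` be a regular local ring and `P` a prime ideal; then
`A_P` is again regular." Proof as printed: `proj dim_A P < ∞` (Thm. 19.2 (I)), so the maximal
ideal `P A_P` of `A_P` has finite projective dimension, and `A_P` is regular by Thm. 19.2.
[cite: Matsumura1987, Thm. 19.3] -/
theorem isRegularLocalRing_localization_atPrime (R : Type u) [CommRing R] [IsRegularLocalRing R]
    (p : Ideal R) [p.IsPrime] : IsRegularLocalRing (Localization.AtPrime p) := by
  obtain ⟨rs, reg, span, _⟩ := exists_isRegular_ofList_eq_maximalIdeal R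
  have hp : HasProjectiveDimensionLE (ModuleCat.of R p) rs.length :=
    hasProjectiveDimensionLE_length_of_isWeaklyRegular reg.toIsWeaklyRegular span (ModuleCat.of R p)
  have h' := hasProjectiveDimensionLE_maximalIdeal_localization p rs.length hp
  apply IsRegularLocalRing.of_maximalIdeal_hasProjectiveDimensionLE.{u, u} (R := Localization.AtPrime p)
  refine ⟨rs.length, ?_⟩
  exact hasProjectiveDimensionLT_of_iso
    (Shrink.linearEquiv.{u} (Localization.AtPrime p) (maximalIdeal (Localization.AtPrime p))).symm.toModuleIso _

end Literature.AlgebraicGeometry.Resolution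

/-! ## Part IV. Discharge of the named facts -/

namespace Literature.AlgebraicGeometry.Resolution

universe u

/-- DISCHARGE of the named fact `Matsumura1987_14_3` (**Matsumura Thm. 14.3**: "A regular local
ring is an integral domain."). [cite: Matsumura1987, Thm. 14.3] -/
theorem Matsumura1987_14_3_holds : Matsumura1987_14_3.{u} := by
  intro R _ hR
  exact isDomain_of_isRegularLocalRing R

/-- DISCHARGE of the named fact `Matsumura1987_19_3` (**Matsumura Thm. 19.3**, Serre: if `A` is a
regular local ring and `P` a prime ideal then `A_P` is again a regular local ring).
[cite: Matsumura1987, Thm. 19.3] -/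
theorem Matsumura1987_19_3_holds : Matsumura1987_19_3.{u} := by
  intro R _ hR P _
  exact isRegularLocalRing_localization_atPrime R P

end Literature.AlgebraicGeometry.Resolution
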